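import Literature.NumberTheory.GaloisRepresentations.LubinTateColemanNorm
import HarnessLib

/-!
# Lubin–Tate data under a change of coefficient ring: `IsLTRing` along a ring isomorphism, `F_f` along a ring map
# (Cassels–Fröhlich VI §3.5; Lubin–Tate 1965 §1 — proofs only)

Topic `NumberTheory/GaloisRepresentations`; namespace `Literature.NumberTheory.GaloisRepresentations.LubinTate` (sequel of
`LubinTate.lean`; companion of `LubinTateComparisonDilation.map_hom` — `φ([a]_{f,g}) = [φa]_{φf,φg}` — and of
`LubinTateColemanNorm`'s `IsLTSeries.map`).  Two transport facts used to move a Lubin–Tate identification proved over one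
avatar of a coefficient ring (e.g. `ℤ_p`) to another (e.g. `𝒪_v` at a place of degree one, `padicIntEquivOfDegreeOne`):

* `IsLTRing.map_ringEquiv` — `(A, π, q)` Lubin–Tate ⟹ `(B, e π, q)` Lubin–Tate for a ring isomorphism `e : A ≃+* B`;
* ★ `map_ltF` — **`φ(F_f) = F_{φf}`** for any ring map `φ : A → B` under which `φ f` is again a Lubin–Tate series over a
  Lubin–Tate base (uniqueness in Lubin–Tate's lemma: both solve `φf ∘ G = G ∘ (φf × φf)`, `G ≡ X₀ + X₁`);
  `map_ltF_ringEquiv` — the case of a ring isomorphism, with the target data produced.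

Consumer: `EllipticCurves/OrdinaryFormalGroupLubinTate` (`V.formalGroupLaw = ltF …` over `ℤ_p`) read over `𝒪_{K_v} ≅ ℤ_p`
(cell `bsd-print-cf2`, seat `bsd-line-cf2c-w4` g12).  Theorems only; no definition, no named fact, no instance.

## References
* [CasselsFrohlichANT1967] J.-P. Serre, *Local class field theory*, Ch. VI of Cassels–Fröhlich (1967), §3.5 Prop. 1, Prop. 5,
  Remark 2 (the hypotheses on the coefficient ring).
* [LubinTate1965] J. Lubin, J. Tate, Ann. of Math. 81 (1965), §1 (4), Lemma 1, Thm. 1.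
-/

noncomputable section

open MvPowerSeries

namespace Literature.NumberTheory.GaloisRepresentations

namespace LubinTate

variable {A : Type*} [CommRing A] {B : Type*} [CommRing B]

/-- **The Lubin–Tate hypotheses transport along a ring isomorphism**: if `(A, π, q)` satisfies `IsLTRing` then so does
`(B, e π, q)` for `e : A ≃+* B`. [cite: CasselsFrohlichANT1967, Ch. VI §3.5 Prop. 5, Remark 2] -/
theorem IsLTRing.map_ringEquiv {π : A} {q : ℕ} (hA : IsLTRing π q) (e : A ≃+* B) : IsLTRing (e π) q := by
  obtain ⟨p, r, hp, hq, hpmem⟩ := hA.exists_prime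
  refine ⟨fun x hx => ?_, fun m hm => ?_, ⟨p, r, hp, hq, ?_⟩, fun b => ?_⟩
  · have h : π * e.symm x = 0 := by
      apply e.injective
      rw [map_mul, e.apply_symm_apply, map_zero]
      exact hx
    simpa using congrArg e (hA.eq_zero_of_mul_eq_zero _ h)
  · simpa using (hA.isUnit_one_sub_pow m hm).map e
  · obtain ⟨c, hc⟩ := Ideal.mem_span_singleton.mp hpmem
    refine Ideal.mem_span_singleton.mpr ⟨e c, ?_⟩
    rw [← map_mul, ← hc, map_natCast]
  · obtain ⟨c, hc⟩ := hA.dvd_pow_sub (e.symm b)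
    refine ⟨e c, ?_⟩
    rw [← map_mul, ← hc, map_sub, map_pow, e.apply_symm_apply]

/-- ★ **`φ(F_f) = F_{φ f}`**: the Lubin–Tate formal group law commutes with a change of coefficient ring — for
`φ : A →+* B`, `f ∈ 𝔉_π` over a Lubin–Tate base `(A, π, q)` and `φ f ∈ 𝔉_{π'}` over a Lubin–Tate base `(B, π', q')`,
`(F_f).map φ = F_{φ f}` (both are `≡ X₀ + X₁` and admit `φ f` as an endomorphism; uniqueness in Lubin–Tate's lemma).
[cite: LubinTate1965, §1 (4), Lemma 1] [cite: CasselsFrohlichANT1967, Ch. VI §3.5 Prop. 1] -/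
theorem map_ltF (φ : A →+* B) {π : A} {q : ℕ} (hA : IsLTRing π q) {f : PowerSeries A} (hf : IsLTSeries π q f)
    {π' : B} {q' : ℕ} (hB : IsLTRing π' q') (hf' : IsLTSeries π' q' (f.map φ)) :
    (ltF hA hf).map φ = ltF hB hf' := by
  refine eq_limit hB hf' hf' ?_ (fun i => ?_) ?_
  · rw [MvPowerSeries.constantCoeff_map, constantCoeff_ltF, map_zero]
  · rw [MvPowerSeries.coeff_map, coeff_ltF_single, map_one]
  · have h := congrArg (MvPowerSeries.map φ) (compLeft_ltF hA hf)
    rw [compLeft, compRight, PowerSeries.map_subst (hasSubst_of_constantCoeff (constantCoeff_ltF hA hf)),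
      MvPowerSeries.map_subst (hasSubst_compRight hf.constantCoeff_eq_zero)] at h
    rw [compLeft, compRight, h]
    congr 1
    funext i
    rw [PowerSeries.map_subst (PowerSeries.HasSubst.X i), MvPowerSeries.map_X]

/-- **`e(F_f) = F_{e f}` along a ring isomorphism**, with the target Lubin–Tate data `(B, e π, q)`, `e f ∈ 𝔉_{eπ}` supplied
(`IsLTRing.map_ringEquiv`, `IsLTSeries.map`). [cite: LubinTate1965, §1 (4), Lemma 1] [cite: CasselsFrohlichANT1967, Ch. VI §3.5 Prop. 1] -/
theorem map_ltF_ringEquiv (e : A ≃+* B) {π : A} {q : ℕ} (hA : IsLTRing π q) {f : PowerSeries A} (hf : IsLTSeries π q f) :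
    (ltF hA hf).map e.toRingHom = ltF (hA.map_ringEquiv e) (hf.map e.toRingHom) :=
  map_ltF e.toRingHom hA hf (hA.map_ringEquiv e) (hf.map e.toRingHom)

/-- A formal group law `G` over `A` that IS `F_f` becomes `F_{e f}` over `B` along a ring isomorphism `e` — the form in which
an identification `V̂ = F_f` proved over one avatar of the coefficient ring (e.g. `ℤ_p`) is read over another (e.g. `𝒪_v` at a
place of degree one). [cite: LubinTate1965, §1 Thm. 1] -/
theorem map_eq_ltF_of_eq_ltF (e : A ≃+* B) {π : A} {q : ℕ} (hA : IsLTRing π q) {f : PowerSeries A} (hf : IsLTSeries π q f)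
    {G : MvPowerSeries (Fin 2) A} (hG : G = ltF hA hf) :
    G.map e.toRingHom = ltF (hA.map_ringEquiv e) (hf.map e.toRingHom) := by
  rw [hG]; exact map_ltF_ringEquiv e hA hf

end LubinTate

end Literature.NumberTheory.GaloisRepresentations
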